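import Summits.CriticalPhenomena.Ising3DConformalLimit.Theses.SynchronousCoupling
import Summits.CriticalPhenomena.Ising3DConformalLimit.Theorems.SynchronousCouplingDilationJoiningsBlockMomentPos
import Summits.CriticalPhenomena.Ising3DConformalLimit.Theorems.SynchronousCouplingDilationJoiningsCovariantReduction
import Summits.CriticalPhenomena.Ising3DConformalLimit.Theorems.SynchronousCouplingDilationJoiningsUnitDefect
import Literature.Probability.LatticeModels.GibbsSpecification
import HarnessLib

/-!
# Line `Sketch` for the crux `DilationJoinings` (stmt-CriticalPhenomena-18762) — lead's skeleton

Route `SynchronousCoupling`, sub-problem `CriticalPhenomena/Ising3DConformalLimit`, crux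
`Summit.CriticalPhenomena.Ising3DConformalLimit.Theses.SynchronousCoupling.DilationJoinings`
(dilation by `p ∈ {2,3}` is an `L²`-approximate factor of the critical Ising measure `μ_c` on `ℤ³`:
window-uniform couplings of the self-normalised `p·b`- and `b`-block spins with defect `≤ C b^(−θ)`).

Composition (card `one-joining-rough-mismatch`, re-typed over tree notions only):

* `stub_blockMomentPos` — block second moments of a critical DLR state are positive,
  `0 < ∫ (∑_{x ∈ [0,n)³} σ_x)² dμ` (`n ≥ 1`): uniqueness at `β_c` (tree theorem
  `hasUniqueGibbsMeasure_criticalBeta_holds`) makes `μ` the free state, GKS I gives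
  `∫ σ_x σ_y dμ ≥ 0`, and the diagonal contributes `n³`.
* `stub_covariantReduction` — for a `(pℤ³, ℤ³)`-stationary pair law `π` (invariant under
  `(σ¹, σ²) ↦ (θ_{p a} σ¹, θ_a σ²)` for every `a ∈ ℤ³`) the mixed second moment of the block pair at
  window position `u` equals the one at `u = 0` (change of variables `a = b·u`).
* `stub_unitDefect` — Hilbert-space step: if `‖r X − Y‖² ≤ e ‖Y‖²` for some amplitude `r ≥ 0`, then the
  SELF-NORMALISED defect `‖X/‖X‖ − Y/‖Y‖‖² ≤ 4 e` (`X`, `Y` the two block sums under the coupling; the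
  norms are computed under the marginals).
* `stub_stationaryJoining` — THE OPEN CORE: for each scale `b` a stationary self-joining of `μ_c` whose
  `u = 0` mismatch `∫ (r S¹_{pb}(0) − S²_b(0))² dπ` is `≤ C b^(−θ) ∫ S_b(0)² dμ`. This is the crux up to
  shift-averaging (DJ's window-uniform couplings average to stationary ones), i.e. a reformulation,
  not a strengthening; the card's single dilation-covariant joining for all scales
  (`OneJoiningRoughMismatch`) implies it verbatim and is the intended attack (octave push-forward (★) +
  coherence-ratio bootstrap).

`DilationJoinings_proof` is real glue (no sorry; the stubs enter by name): constants `(4C, θ)`, the coupling of the stub, the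
window removed by `stub_covariantReduction`, the normalisers handled by `stub_unitDefect` with
`e = C b^(−θ)`, positivity of both normalisers from `stub_blockMomentPos` at `n = p b` and `n = b`.
-/

noncomputable section

namespace Summit.CriticalPhenomena.Ising3DConformalLimit.Cruxes.DilationJoinings.Sketch

open MeasureTheory Literature.Probability.LatticeModels
open Summit.CriticalPhenomena.Ising3DConformalLimit.Theses.SynchronousCoupling (DilationJoinings)

/-! ## The stubs

Landed (imported, `--supports stmt-CriticalPhenomena-18762`):
* `stub_blockMomentPos` — `Theorems/SynchronousCouplingDilationJoiningsBlockMomentPos.lean` (p158604);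
* `stub_covariantReduction` — `Theorems/SynchronousCouplingDilationJoiningsCovariantReduction.lean` (p158620);
* `stub_unitDefect` — `Theorems/SynchronousCouplingDilationJoiningsUnitDefect.lean` (p158901).
Open: `stub_stationaryJoining` (below). -/

/-- **Stub 4 (THE OPEN CORE: stationary dilation joinings, scale by scale).** For the critical state
`μ` and `p ∈ {2,3}` there are `C, θ > 0` such that for every `b ≥ 1` there is a coupling `π` of `μ`
with `μ`, invariant under the skew shifts `(θ_{p•a}, θ_a)`, `a ∈ ℤ³`, and an amplitude `r ≥ 0` with
`∫ (r S¹_{pb}(0) − S²_b(0))² dπ ≤ C b^(−θ) ∫ S_b(0)² dμ`. Equivalent to the crux up to shift-averaging;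
implied verbatim by the card's `OneJoiningRoughMismatch` (one dilation-covariant joining for all scales). -/
theorem stub_stationaryJoining :
    ∀ μ ∈ isingGibbsMeasures 3 (criticalBeta 3) 0, IsTranslationInvariantMeasure μ →
      ∀ p : ℕ, (p = 2 ∨ p = 3) → ∃ C θ : ℝ, 0 < θ ∧ ∀ b : ℕ, 1 ≤ b →
        ∃ π : Measure (SpinConfig (Site 3) × SpinConfig (Site 3)), π.fst = μ ∧ π.snd = μ ∧
          (∀ a : Site 3, π.map (fun q => (configShift (fun i => (p:ℤ) * a i) q.1, configShift a q.2)) = π) ∧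
          ∃ r : ℝ, 0 ≤ r ∧
            ∫ q, (r * (∑ x ∈ Fintype.piFinset (fun _ : Fin 3 => Finset.Ico (0:ℤ) ((p:ℤ) * b)), spinAt x q.1)
                - (∑ x ∈ Fintype.piFinset (fun _ : Fin 3 => Finset.Ico (0:ℤ) ((b:ℤ))), spinAt x q.2)) ^ 2 ∂π
              ≤ C * (b : ℝ) ^ (-θ) *
                ∫ σ, (∑ x ∈ Fintype.piFinset (fun _ : Fin 3 => Finset.Ico (0:ℤ) ((b:ℤ))), spinAt x σ) ^ 2 ∂μ := by
  sorry

/-! ## The composition (real glue; the stubs enter BY NAME) -/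

/-- **The crux `DilationJoinings`** (stmt-CriticalPhenomena-18762), BY NAME, from the four stubs of the
line `Sketch`: constants `(4C, θ)` from `stub_stationaryJoining`, its coupling `π` for the scale `b`,
the window removed by `stub_covariantReduction`, the normalisers handled by `stub_unitDefect` with
`e = C b^(−θ)`, both normalisers positive by `stub_blockMomentPos` at `n = p b` and `n = b`. -/
theorem DilationJoinings_proof : DilationJoinings := by
  intro μ hμ hTI p hp
  obtain ⟨C, θ, hθ, hb⟩ := stub_stationaryJoining μ hμ hTI p hp
  refine ⟨4 * C, θ, hθ, fun b m hb1 => ?_⟩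
  obtain ⟨π, hfst, hsnd, hcov, r, hr, hdef⟩ := hb b hb1
  refine ⟨π, hfst, hsnd, fun u _hu => ?_⟩
  haveI : IsProbabilityMeasure μ :=
    ((mem_isingGibbsMeasures_iff _ _ _ _).1 hμ).isProbabilityMeasure
  have hp1 : (1:ℤ) ≤ (p:ℤ) := by rcases hp with rfl | rfl <;> norm_num
  have hb1' : (1:ℤ) ≤ (b:ℤ) := by exact_mod_cast hb1
  have hA : 0 < ∫ σ, (∑ x ∈ Fintype.piFinset (fun _ : Fin 3 => Finset.Ico (0:ℤ) ((p:ℤ) * b)),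
      spinAt x σ) ^ 2 ∂μ := stub_blockMomentPos μ hμ ((p:ℤ) * b) (by nlinarith)
  have hB : 0 < ∫ σ, (∑ x ∈ Fintype.piFinset (fun _ : Fin 3 => Finset.Ico (0:ℤ) ((b:ℤ))),
      spinAt x σ) ^ 2 ∂μ := stub_blockMomentPos μ hμ (b:ℤ) hb1'
  have key := stub_covariantReduction p b π hcov
    (Real.sqrt (∫ σ, (∑ x ∈ Fintype.piFinset (fun _ : Fin 3 => Finset.Ico (0:ℤ) ((p:ℤ) * b)),
      spinAt x σ) ^ 2 ∂μ))⁻¹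
    (Real.sqrt (∫ σ, (∑ x ∈ Fintype.piFinset (fun _ : Fin 3 => Finset.Ico (0:ℤ) ((b:ℤ))),
      spinAt x σ) ^ 2 ∂μ))⁻¹ u
  rw [key]
  have h := stub_unitDefect μ π (Fintype.piFinset (fun _ : Fin 3 => Finset.Ico (0:ℤ) ((p:ℤ) * b)))
    (Fintype.piFinset (fun _ : Fin 3 => Finset.Ico (0:ℤ) ((b:ℤ)))) r (C * (b : ℝ) ^ (-θ))
    inferInstance hfst hsnd hr hA hB hdef
  calc _ ≤ 4 * (C * (b : ℝ) ^ (-θ)) := h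
    _ = 4 * C * (b : ℝ) ^ (-θ) := by ring

end Summit.CriticalPhenomena.Ising3DConformalLimit.Cruxes.DilationJoinings.Sketch

end
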